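import Summits.AtomisticToContinuum.Crystallization.Theorems.FreeSplittingCertificatesStrictSplittingRuleCoreDefsStar

/-!
# `StrictSplittingRule` (stmt-AtomisticToContinuum-12560), line `registered`: the JOINT first+second-order sitewise certificate (reshape r6)

Route `FreeSplittingCertificates`, crux r3 `StrictSplittingRule`, line `registered` (lead c5, 2026-08-17).  Why a sixth
reshape of the perturbative core.  Up to r5 the core was split as H1 (`CoreFirstOrderDesign`, landed) ∧ H2⋆
(`CoreStarCoercive`, sitewise second-order coercivity) ⇒ H3⋆ (`CoreStarAssembly`).  Two independent analyses (the lead's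
far-field/chart analysis, FAR-FIELD-ANALYSIS.md on the item, and the wave-2 H3⋆-scope worker, H3-SCOPE.md on the item)
found that "H1 ∧ H2⋆ ⇒ core" is not assemblable for ANY constants, for a structural reason:

* the rule is ONE bond function, so H1's first-order transfers must act on a ROTATION-INVARIANT readout of the stencil
  bonds (the exact squared-length deviation `ẽ_s(m) = ½(‖x_{m+s}−x_m‖² − ‖y_s‖²)`), whereas H1 is an identity in the
  LINEARISED readouts `dl_s(m) = ⟨y_s, Δ_s u_m⟩` of one global chart; since `ẽ = dl + ½‖Δ_s u_m‖²`, the first-order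
  transfers leave in every site's SECOND-order ledger the signed READOUT FORM
  `Σ_{q≠p} Σ_{s∈Y₁} [β(b_p)(q−p)(s)·½‖Δ_s u_p‖² − β(b_q)(p−q)(s)·½‖Δ_s u_q‖²]`,
  which no readout design removes, which H2⋆ does not contain, and which is not dominated by the site's own norms
  (witness, H3-SCOPE.md Q2: one second-shell site displaced by δ, everything else exact — κ-norms and cubic remainder at
  p vanish, the form is `−0.0398 δ²` for the landed line truss);
* the κ₃-charge of the cubic remainder and the strictness read-off are legitimate only in p's OWN least-squares
  co-rotated chart, i.e. with `u` replaced by `u − W(y − y_p)` for the best skew fit `W` of p's shell; in that chart the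
  bare prestress is `½W′(s_q)‖Δu_q − W(y_q−y_p)‖²` (linearised rotations about p become exact symmetries of the
  truncated form instead of negative modes — FAR-FIELD-ANALYSIS.md §1, §4).

Hence the interface the assembly consumes is ONE joint certificate: a first-order design `β` (with H1's identity) AND
second-order tables `M, N`, such that at every site, in p's least-squares chart, the naive half-split second variation
plus the quadratic transfers dominates `κ₁·Σ_shell stretch² + κ₃·Σ_shell‖Δu − W y‖² +` the readout form of `β`.
This file states it: `CoreJointSiteIneq` (the sitewise inequality), `CoreJointCoercive a h κ₁ κ₃` (H12⋆),
`CoreJointAssembly κ₁ κ₃ N₀ a h` (H3′: H12⋆ ⇒ `PerturbativeCore`), the registered anchor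
`stub_perturbativeCoreOfJointPieces` (composition, proved) and `coreFirstOrderDesign_of_joint` (H1 is the projection of
H12⋆).  Line-internal proof obligations ([folklore] bookkeeping); nothing landed assumes them.  Constants are
parameters; the skeleton instantiates them after the torus numerics of the joint form (NOTES.md / item evidence).
-/

noncomputable section

namespace Summit.AtomisticToContinuum.Crystallization.Theorems.StrictSplittingRuleBirth

open scoped BigOperators Classical
open Literature.MathematicalPhysics.StatisticalMechanics
open Literature.Geometry.DiscreteGeometry
open Summit.AtomisticToContinuum.Crystallization.Theorems.PalmUnimodularRigidity.LayeredLawsSelectHcp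
  (hcpSite ljSqDeriv)

/-- **The joint sitewise inequality at `p`** for the displacement field `u`, the first-order design `(Y₁, β)` and the
second-order tables `(Y₂, M, N)`, in p's least-squares co-rotated chart: for a skew `W` that is a best fit of p's
first-shell relative displacements by an infinitesimal rotation,
`κ₁·Σ_shell⟨y_q−y_p,u_q−u_p⟩² + κ₃·Σ_shell‖u_q−u_p−W(y_q−y_p)‖²`
`+ Σ'_{q≠p} Σ_{s∈Y₁} [β(b q)(p−q)(s)·½‖u_{q+s}−u_q−W(y_{q+s}−y_q)‖² − β(b p)(q−p)(s)·½‖u_{p+s}−u_p−W(y_{p+s}−y_p)‖²]`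
(the READOUT FORM of the first-order design, moved to the demand side) is at most
`Σ'_{q≠p} [½W′(s_q)‖u_q−u_p−W(y_q−y_p)‖² + W″(s_q)⟨y_q−y_p,u_q−u_p⟩²]` (naive half-split second variation, prestress
co-rotated; `⟨d, W d⟩ = 0`) plus the antisymmetrised quadratic transfers of `(Y₂, M, N)` at `p` (as in `CoreStarCoercive`).
[folklore] -/
def CoreJointSiteIneq (a h κ₁ κ₃ : ℝ) (Y₁ : Finset (ℤ × ℤ × ℤ)) (β : Bool → (ℤ × ℤ × ℤ) → (ℤ × ℤ × ℤ) → ℝ)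
    (Y₂ : Finset (ℤ × ℤ × ℤ)) (M N : Bool → (ℤ × ℤ × ℤ) → (ℤ × ℤ × ℤ) → (ℤ × ℤ × ℤ) → ℝ)
    (u : ℤ × ℤ × ℤ → EuclideanSpace ℝ (Fin 3)) (p : ℤ × ℤ × ℤ) : Prop :=
  ∃ W : EuclideanSpace ℝ (Fin 3) →ₗ[ℝ] EuclideanSpace ℝ (Fin 3),
    (∀ z : EuclideanSpace ℝ (Fin 3), inner ℝ (W z) z = 0) ∧
    (∀ W' : EuclideanSpace ℝ (Fin 3) →ₗ[ℝ] EuclideanSpace ℝ (Fin 3), (∀ z : EuclideanSpace ℝ (Fin 3), inner ℝ (W' z) z = 0) →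
      (∑' q : ℤ × ℤ × ℤ,
          (if 0 < ‖hcpSite a h q - hcpSite a h p‖ ∧ ‖hcpSite a h q - hcpSite a h p‖ ≤ 11 / 10 * a then
            ‖u q - u p - W (hcpSite a h q - hcpSite a h p)‖ ^ 2 else (0 : ℝ))) ≤
      (∑' q : ℤ × ℤ × ℤ,
          (if 0 < ‖hcpSite a h q - hcpSite a h p‖ ∧ ‖hcpSite a h q - hcpSite a h p‖ ≤ 11 / 10 * a then
            ‖u q - u p - W' (hcpSite a h q - hcpSite a h p)‖ ^ 2 else (0 : ℝ)))) ∧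
    κ₁ * (∑' q : ℤ × ℤ × ℤ,
        (if 0 < ‖hcpSite a h q - hcpSite a h p‖ ∧ ‖hcpSite a h q - hcpSite a h p‖ ≤ 11 / 10 * a then
          (inner ℝ (hcpSite a h q - hcpSite a h p) (u q - u p)) ^ 2 else (0 : ℝ))) +
    κ₃ * (∑' q : ℤ × ℤ × ℤ,
        (if 0 < ‖hcpSite a h q - hcpSite a h p‖ ∧ ‖hcpSite a h q - hcpSite a h p‖ ≤ 11 / 10 * a then
          ‖u q - u p - W (hcpSite a h q - hcpSite a h p)‖ ^ 2 else (0 : ℝ))) +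
    (∑' q : ℤ × ℤ × ℤ, (if q = p then (0 : ℝ) else
        ∑ s ∈ Y₁,
          (β (decide (Even q.1)) (p - q) s *
              (1 / 2 * ‖u (q + s) - u q - W (hcpSite a h (q + s) - hcpSite a h q)‖ ^ 2) -
            β (decide (Even p.1)) (q - p) s *
              (1 / 2 * ‖u (p + s) - u p - W (hcpSite a h (p + s) - hcpSite a h p)‖ ^ 2)))) ≤
    (∑' q : ℤ × ℤ × ℤ, (if q = p then (0 : ℝ) else
        1 / 2 * (ljSqDeriv (‖hcpSite a h q - hcpSite a h p‖ ^ 2) *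
            ‖u q - u p - W (hcpSite a h q - hcpSite a h p)‖ ^ 2 +
          2 * (1 / 2 * (7 * ((‖hcpSite a h q - hcpSite a h p‖ ^ 2)⁻¹) ^ 8 -
            4 * ((‖hcpSite a h q - hcpSite a h p‖ ^ 2)⁻¹) ^ 5)) *
            (inner ℝ (hcpSite a h q - hcpSite a h p) (u q - u p)) ^ 2))) +
    (∑' q : ℤ × ℤ × ℤ, (if q = p then (0 : ℝ) else
        ∑ s ∈ Y₂, ∑ s' ∈ Y₂,
          (M (decide (Even p.1)) (q - p) s s' *
              (inner ℝ (hcpSite a h (p + s) - hcpSite a h p) (u (p + s) - u p) *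
                inner ℝ (hcpSite a h (p + s') - hcpSite a h p) (u (p + s') - u p)) -
            M (decide (Even q.1)) (p - q) s s' *
              (inner ℝ (hcpSite a h (q + s) - hcpSite a h q) (u (q + s) - u q) *
                inner ℝ (hcpSite a h (q + s') - hcpSite a h q) (u (q + s') - u q)) +
            (N (decide (Even p.1)) (q - p) s s' - N (decide (Even q.1)) (p - q) s' s) *
              (inner ℝ (hcpSite a h (p + s) - hcpSite a h p) (u (p + s) - u p) *
                inner ℝ (hcpSite a h (q + s') - hcpSite a h q) (u (q + s') - u q)))))

/-- **H12⋆ — the JOINT first+second-order sitewise certificate** of the relaxed Lennard-Jones hcp crystal with constants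
`κ₁` (radial stretches) and `κ₃` (recentred rotations): one finite first-order stencil `Y₁` with Bravais-covariant
`(1+r)⁻⁶`-decaying linear transfers `β` that CANCEL the naive half-split first variation at every site (H1's identity,
verbatim `CoreFirstOrderDesign`), and one finite second-order stencil `Y₂` with covariant decaying antisymmetric quadratic
transfers `M, N`, such that the joint sitewise inequality `CoreJointSiteIneq` holds at every site for every finitely
supported displacement field.  The registered form of the perturbative core's hypothesis after reshape r6 (stub
`stub_coreJointCoercive`); truth = an infinite-dimensional covariant LMI, finite models = periodic supercells. [folklore] -/
def CoreJointCoercive (a h κ₁ κ₃ : ℝ) : Prop :=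
  ∃ (C : ℝ) (Y₁ : Finset (ℤ × ℤ × ℤ)) (β : Bool → (ℤ × ℤ × ℤ) → (ℤ × ℤ × ℤ) → ℝ)
    (Y₂ : Finset (ℤ × ℤ × ℤ)) (M N : Bool → (ℤ × ℤ × ℤ) → (ℤ × ℤ × ℤ) → (ℤ × ℤ × ℤ) → ℝ),
    (∀ b d s, s ∉ Y₁ → β b d s = 0) ∧
    (∀ p q : ℤ × ℤ × ℤ, ∀ s, |β (decide (Even p.1)) (q - p) s| ≤
        C * ((1 + ‖hcpSite a h q - hcpSite a h p‖)⁻¹) ^ 6) ∧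
    (∀ b d s s', s ∉ Y₂ ∨ s' ∉ Y₂ → M b d s s' = 0 ∧ N b d s s' = 0) ∧
    (∀ p q : ℤ × ℤ × ℤ, ∀ s s', |M (decide (Even p.1)) (q - p) s s'| ≤
        C * ((1 + ‖hcpSite a h q - hcpSite a h p‖)⁻¹) ^ 6 ∧
      |N (decide (Even p.1)) (q - p) s s'| ≤ C * ((1 + ‖hcpSite a h q - hcpSite a h p‖)⁻¹) ^ 6) ∧
    (∀ u : ℤ × ℤ × ℤ → EuclideanSpace ℝ (Fin 3), (Function.support u).Finite → ∀ p : ℤ × ℤ × ℤ,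
      (∑' q : ℤ × ℤ × ℤ, (if q = p then (0 : ℝ) else
          ljSqDeriv (‖hcpSite a h q - hcpSite a h p‖ ^ 2) *
            inner ℝ (hcpSite a h q - hcpSite a h p) (u q - u p))) +
      (∑' q : ℤ × ℤ × ℤ, (if q = p then (0 : ℝ) else
          ∑ s ∈ Y₁, (β (decide (Even p.1)) (q - p) s *
              inner ℝ (hcpSite a h (p + s) - hcpSite a h p) (u (p + s) - u p) -
            β (decide (Even q.1)) (p - q) s *
              inner ℝ (hcpSite a h (q + s) - hcpSite a h q) (u (q + s) - u q)))) = 0) ∧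
    (∀ u : ℤ × ℤ × ℤ → EuclideanSpace ℝ (Fin 3), (Function.support u).Finite → ∀ p : ℤ × ℤ × ℤ,
      CoreJointSiteIneq a h κ₁ κ₃ Y₁ β Y₂ M N u p)

/-- The first-order half of the joint certificate IS H1: `CoreJointCoercive ⇒ CoreFirstOrderDesign` (projection). -/
theorem coreFirstOrderDesign_of_joint {a h κ₁ κ₃ : ℝ} :
    CoreJointCoercive a h κ₁ κ₃ → CoreFirstOrderDesign a h := by
  rintro ⟨C, Y₁, β, Y₂, M, N, hY₁, hβ, -, -, hid, -⟩
  exact ⟨Y₁, β, C, hY₁, hβ, hid⟩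

/-- **H3′ — the quantitative assembly from the JOINT certificate** (the registered form of H3 after reshape r6): at the
family minimiser, `CoreJointCoercive a h κ₁ κ₃` ⇒ `PerturbativeCore δ a t η₀ e(hcp(a,h))` for every hard core `δ`,
`|t| ≤ 1/100` and `0 < η₀ ≤ a/N₀`.  Intended proof (H3-SCOPE.md §Q2 "what the assembly must do"; ASSEMBLY-ARCHITECTURE.md
of lead c4 where still applicable): per-site least-squares co-rotated chart for p's whole ledger; rule
`½ + [β·g + M,N-products of g − cubic corrections]/V` with ONE rotation-invariant readout `g`; the joint certificate
covers the second-order ledger INCLUDING the readout form of `β`; first-shell cubic remainders `≤ 0.162·Σx² + 0.0015·Σy²`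
at `ρ = 1/100` charged to `κ₁a²/1.3`, `κ₃/1.3`; strictness from `κ₃`; charts of two-shell-good regions; bad sites absorb
via the composite rule.  Line-internal proof obligation (stub `stub_coreJointAssembly`). [folklore] -/
def CoreJointAssembly (κ₁ κ₃ N₀ a h : ℝ) : Prop :=
  0 < a → 0 < h → HcpFamilyMin a h → CoreJointCoercive a h κ₁ κ₃ →
    ∀ δ : ℝ, 0 < δ → ∀ t η₀ : ℝ, |t| ≤ 1 / 100 → h = (1 + t) * a * Real.sqrt (2 / 3) →
      ∀ (ha : a ≠ 0) (hh : h ≠ 0), 0 < η₀ → η₀ ≤ a / N₀ →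
        PerturbativeCore δ a t η₀ ((hcpPeriodicConfiguration ha hh).energyPerParticle lennardJones)

/-- **Registered anchor `stub_perturbativeCoreOfJointPieces` (reshape r6): the core from H12⋆(κ₁,κ₃) at family
minimisers and H3′(κ₁,κ₃,N₀), at tolerance fraction `1/N₀`.** -/
theorem stub_perturbativeCoreOfJointPieces : ∀ κ₁ κ₃ N₀ : ℝ,
    (∀ a h : ℝ, 0 < a → 0 < h → HcpFamilyMin a h → CoreJointCoercive a h κ₁ κ₃) →
    (∀ a h : ℝ, CoreJointAssembly κ₁ κ₃ N₀ a h) →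
    ∀ δ : ℝ, 0 < δ → ∀ a h t η₀ : ℝ, 0 < a → |t| ≤ 1 / 100 →
      h = (1 + t) * a * Real.sqrt (2 / 3) → HcpFamilyMin a h → ∀ (ha : a ≠ 0) (hh : h ≠ 0),
        0 < η₀ → η₀ ≤ a / N₀ →
          PerturbativeCore δ a t η₀ ((hcpPeriodicConfiguration ha hh).energyPerParticle lennardJones) := by
  intro κ₁ κ₃ N₀ h12 h3 δ hδ a h t η₀ ha ht hht hfam ha' hh' hη₀ hη
  have hpos : 0 < h := by
    have h1t : 0 < 1 + t := by have := (abs_le.1 ht).1; linarith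
    rw [hht]
    exact mul_pos (mul_pos h1t ha) (Real.sqrt_pos.2 (by norm_num))
  exact h3 a h ha hpos hfam (h12 a h ha hpos hfam) δ hδ t η₀ ht hht ha' hh' hη₀ hη

end Summit.AtomisticToContinuum.Crystallization.Theorems.StrictSplittingRuleBirth

end
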